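import Summits.QuantumAdvantage.QuantumAdvantage.Theorems.LinnikCubicClassGroupsPureCubicClassGroupFBQPStubCubicFieldFacts
import Literature.NumberTheory.LFunctions.UniformClassGroupPNTGeneralDegreeInputs

/-!
# Crux `LinnikCubicClassGroups.PureCubicClassNumberHard` (stmt-QuantumAdvantage-11826) —
# stub `stub_classNumber_le`

Line `Sketch` (honda-leak arm), stub `stub_classNumber_le` (M): an explicit class number bound for
pure cubic fields fitting the crux's window of `2|x|+8` bits. For a cubic number field `K ∋ α`,
`α³ = m`, `m` a non-cube natural number, `h_K ≤ 48 m²`: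

* Minkowski (Mathlib `NumberField.exists_ideal_in_class_of_norm_le`): every ideal class contains a
  nonzero integral ideal of norm `≤ B := (4/π)^{r₂} · (3!/3³) · √|d_K|`, and
  `B² ≤ (4/3)² · (2/9)² · 27 m² = (64/27) m²` (`π > 3`, `r₂ ≤ 1`, and the tree's
  `factsDiscr : |d_K| ≤ 27 m²`);
* the tree's uniform ideal count
  `card_nonZeroDivisors_absNorm_le_le : #{𝔞 ≠ 0 : N𝔞 ≤ N} ≤ N² e^{n_K}` with `N = ⌊B⌋`;
* `(64/27) · e³ ≤ (64/27) · 20.25 = 48` (`e < 2.7182818286`, Mathlib `Real.exp_one_lt_d9`).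
-/

namespace Summit.QuantumAdvantage.QuantumAdvantage.Theorems.LinnikCubicClassGroups

open scoped NumberField nonZeroDivisors

section minkowski

variable {K : Type*} [Field K] [NumberField K]

open NumberField NumberField.InfinitePlace Module Real in
/-- The square of the Minkowski bound of a cubic field `K ∋ α`, `α³ = m` (`m` a non-cube) is at
most `(64/27) m²`: `(4/π)^{r₂} ≤ 4/3`, `3!/3³ = 2/9`, `|d_K| ≤ 27 m²`. -/
theorem hard_minkowski_sq_le (hdeg : Module.finrank ℚ K = 3) {m : ℕ} (hm : ∀ r : ℕ, r ^ 3 ≠ m)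
    {α : K} (hα : α ^ 3 = (m : K)) :
    ((4 / π) ^ nrComplexPlaces K *
        ((Nat.factorial (finrank ℚ K) : ℝ) / (finrank ℚ K : ℝ) ^ finrank ℚ K *
          √|(discr K : ℝ)|)) ^ 2 ≤ 64 / 27 * (m : ℝ) ^ 2 := by
  have hr2 : nrComplexPlaces K ≤ 1 := by
    have := card_add_two_mul_card_eq_rank K; omega
  have ha0 : (0 : ℝ) ≤ (4 / π) ^ nrComplexPlaces K := by positivity
  have ha : (4 / π : ℝ) ^ nrComplexPlaces K ≤ 4 / 3 := by
    rcases Nat.le_one_iff_eq_zero_or_eq_one.mp hr2 with h | h <;> rw [h]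
    · norm_num
    · rw [pow_one, div_le_iff₀ Real.pi_pos]
      linarith [Real.pi_gt_three]
  have ha2 : ((4 / π : ℝ) ^ nrComplexPlaces K) ^ 2 ≤ (4 / 3) ^ 2 := pow_le_pow_left₀ ha0 ha 2
  have hc : ((Nat.factorial (finrank ℚ K) : ℝ) / (finrank ℚ K : ℝ) ^ finrank ℚ K) = 2 / 9 := by
    rw [hdeg]; norm_num [Nat.factorial]
  have hs : √|(discr K : ℝ)| ^ 2 ≤ 27 * (m : ℝ) ^ 2 := by
    rw [Real.sq_sqrt (abs_nonneg _)]
    have h := factsDiscr hdeg hm hα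
    have h' : ((|discr K| : ℤ) : ℝ) ≤ 27 * (m : ℝ) ^ 2 := by exact_mod_cast h
    rwa [Int.cast_abs] at h'
  rw [hc, mul_pow, mul_pow]
  calc ((4 / π : ℝ) ^ nrComplexPlaces K) ^ 2 * ((2 / 9 : ℝ) ^ 2 * √|(discr K : ℝ)| ^ 2)
      ≤ (4 / 3 : ℝ) ^ 2 * ((2 / 9 : ℝ) ^ 2 * (27 * (m : ℝ) ^ 2)) := by gcongr
    _ = 64 / 27 * (m : ℝ) ^ 2 := by ring

end minkowski

/-- `e³ ≤ 20.25 = 81/4` (from `e < 2.7182818286`, so `e³ < 20.09`). -/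
theorem hard_exp_three_le : Real.exp ((3 : ℕ) : ℝ) ≤ 81 / 4 := by
  rw [← Real.exp_one_pow]
  have h := pow_le_pow_left₀ (Real.exp_pos 1).le Real.exp_one_lt_d9.le 3
  exact h.trans (by norm_num)

open NumberField in
/-- **Stub `stub_classNumber_le`** (line `Sketch`, honda-leak arm): for a cubic number field
`K ∋ α` with `α³ = m`, `m` a non-cube natural number, `h_K ≤ 48 m²`. Minkowski: every class
contains a nonzero integral ideal of norm `≤ B` with `B² ≤ (64/27) m²` (`hard_minkowski_sq_le`,
from `|d_K| ≤ 27 m²`); there are at most `N² e³` nonzero ideals of norm `≤ N = ⌊B⌋`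
(`card_nonZeroDivisors_absNorm_le_le`); and `(64/27) e³ ≤ 48`. -/
theorem stub_classNumber_le :
    ∀ (K : Type) [Field K] [NumberField K], Module.finrank ℚ K = 3 →
      ∀ m : ℕ, (∀ r : ℕ, r ^ 3 ≠ m) → (∃ α : K, α ^ 3 = (m : K)) →
        NumberField.classNumber K ≤ 48 * m ^ 2 := by
  intro K _ _ hdeg m hm hα
  obtain ⟨α, hα⟩ := hα
  classical
  set B : ℝ := (4 / Real.pi) ^ InfinitePlace.nrComplexPlaces K *
    ((Nat.factorial (Module.finrank ℚ K) : ℝ) / (Module.finrank ℚ K : ℝ) ^ Module.finrank ℚ K *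
      √|(discr K : ℝ)|) with hB
  have hB0 : 0 ≤ B := by positivity
  set N : ℕ := ⌊B⌋₊ with hN
  -- `h_K ≤ #{𝔞 ≠ 0 : N𝔞 ≤ N}` (Minkowski)
  haveI : Finite {I : (Ideal (𝓞 K))⁰ // Ideal.absNorm (I : Ideal (𝓞 K)) ≤ N} :=
    (Ideal.finite_setOf_absNorm_le₀ N).to_subtype
  have h1 : classNumber K ≤
      Nat.card {I : (Ideal (𝓞 K))⁰ // Ideal.absNorm (I : Ideal (𝓞 K)) ≤ N} := by
    rw [classNumber, ← Nat.card_eq_fintype_card]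
    refine Nat.card_le_card_of_surjective (fun I ↦ ClassGroup.mk0 I.1) fun C ↦ ?_
    obtain ⟨I, hI, hle⟩ := exists_ideal_in_class_of_norm_le C
    exact ⟨⟨I, Nat.le_floor hle⟩, hI⟩
  -- `#{𝔞 ≠ 0 : N𝔞 ≤ N} ≤ N² e³ ≤ B² e³ ≤ (64/27) m² · (81/4) = 48 m²`
  have h2 := Literature.NumberTheory.LFunctions.NumberField.card_nonZeroDivisors_absNorm_le_le K N
  have hNB : (N : ℝ) ≤ B := Nat.floor_le hB0
  have hB2 : B ^ 2 ≤ 64 / 27 * (m : ℝ) ^ 2 := hard_minkowski_sq_le hdeg hm hα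
  have he : Real.exp (Module.finrank ℚ K : ℝ) ≤ 81 / 4 := by rw [hdeg]; exact hard_exp_three_le
  have hreal : (classNumber K : ℝ) ≤ 48 * (m : ℝ) ^ 2 :=
    calc (classNumber K : ℝ)
        ≤ Nat.card {I : (Ideal (𝓞 K))⁰ // Ideal.absNorm (I : Ideal (𝓞 K)) ≤ N} := by
          exact_mod_cast h1
      _ ≤ (N : ℝ) ^ 2 * Real.exp (Module.finrank ℚ K) := h2
      _ ≤ B ^ 2 * Real.exp (Module.finrank ℚ K) := by gcongr
      _ ≤ 64 / 27 * (m : ℝ) ^ 2 * (81 / 4) := by gcongr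
      _ = 48 * (m : ℝ) ^ 2 := by ring
  exact_mod_cast hreal

end Summit.QuantumAdvantage.QuantumAdvantage.Theorems.LinnikCubicClassGroups
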